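import Literature.NumberTheory.Automorphic.RankinSelbergLocal
import Literature.NumberTheory.Automorphic.IrreducibleClasses
import Literature.NumberTheory.Automorphic.WhittakerModels
import Literature.NumberTheory.Automorphic.ReductiveGroupData
import Literature.NumberTheory.Automorphic.TateLocalFactors
import Literature.NumberTheory.Automorphic.GL2SphericalOfLFactorDegreeTwo
import HarnessLib

/-!
# Degree-2 local `L`-factor forces sphericality on `GL₂` (Jacquet–Langlands 1970) — the named fact

Topic `Literature/NumberTheory/Automorphic`. ONE named fact (D-0014), no proofs:
`JacquetLanglands1970_spherical_of_natDegree_lFactor_eq_two`, VERBATIM the hypothesis `hJL`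
(a section `variable`, (JL) of the module docstring) of the accepted reduction
`Literature.NumberTheory.Automorphic.Langlands1980_quadraticBaseChange_frobCompatible_of_localGlobal_of_lFactor`
(`QuadraticBaseChangeFrobCompatibleOfLFactorProofs.lean` ll. 277–288, p115567) — librarian sweep g24,
vend-from-binder, promote events 3311547 / 3311793 (the provefact seat may not mint it,
`lint.fact-fanout`). First consumer: that reduction, whence
`Langlands1980_quadraticBaseChange_frobCompatible_holds` is the term
`…_of_localGlobal_of_lFactor ‹JL›_holds ‹five existing apex facts›_holds`.

## Source and reading

Jacquet–Langlands, *Automorphic Forms on GL(2)* (LNM 114, 1970), Props. 3.5–3.6 with Thm. 2.18 (the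
local factors of the principal series, special and supercuspidal representations), and Gelbart,
*Automorphic forms on adele groups* (1975), Thm. 6.15 (table of `L(s, π)`) with Thm. 4.23 (class-one
= unramified principal series): for an irreducible smooth (admissible: Jacquet 1975 / Bernstein 1974)
`ψ`-generic representation `π` of `GL₂(F)`, `F` non-archimedean local of characteristic `0`, the
Euler factor `L(s, π) = L(s, π × 𝟙_{GL₁})` has degree `2` in `q^{-s}` ONLY for the unramified
principal series, which are exactly the spherical generic representations (non-zero
`GL₂(𝒪_F)`-fixed vector). In the tree's vocabulary: `SmoothIrrep` (`IrreducibleClasses.lean`),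
`IsGeneric … ψ` (`WhittakerModels.lean`), `AddChar.IsContinuousNontrivial` (`TateLocalFactors.lean`),
the JPSS factor `HasRSLFactor Nat.one_lt_two π.ρ 𝟙 ψ ν P` (`RankinSelbergLocal.lean`, any
invariant Radon `ν` on `GL₁(F) ⧸ U₁`), `glInt 2 F = GL₂(𝒪_F)` (`ReductiveGroupData.lean`).

What is deliberately NOT here: the classification of irreducible representations of `GL₂(F)` and the
computation of their `L`-factors, from which the statement follows by inspection of the table.
-/

noncomputable section

open scoped MatrixGroups Matrix
open Polynomial MeasureTheory

namespace Literature.NumberTheory.Automorphic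

/-- **Jacquet–Langlands 1970 / Gelbart 1975 Thm. 6.15 with Thm. 4.23: a `ψ`-generic irreducible
smooth representation of `GL₂(F)` whose JPSS `L`-polynomial against the trivial representation of
`GL₁(F)` has degree `2` is spherical.** For every non-archimedean local field `F` of characteristic
zero, every `πv : SmoothIrrep (GL (Fin 2) F)`, every non-trivial continuous `ψ : AddChar F Circle`
with `πv` `ψ`-generic, if for every invariant Radon measure `ν` on `GL₁(F) ⧸ U₁(F)` there is a
polynomial `P` with `HasRSLFactor Nat.one_lt_two πv.ρ (Representation.trivial ℂ (GL (Fin 1) F) ℂ) ψ ν P`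
and `P.natDegree = 2`, then `πv` has a non-zero vector fixed by `glInt 2 F = GL₂(𝒪_F)` (only the
unramified principal series have an Euler factor of degree `2`: JL Props. 3.5–3.6, Thm. 2.18;
Gelbart Thm. 6.15, and those are the class-one representations, Gelbart Thm. 4.23). VERBATIM the
hypothesis `hJL` of `Langlands1980_quadraticBaseChange_frobCompatible_of_localGlobal_of_lFactor`;
users take `(hJL : JacquetLanglands1970_spherical_of_natDegree_lFactor_eq_two)`. Named fact
(D-0014), not proved in the tree.
[cite: JacquetLanglands1970, Props. 3.5–3.6 and Thm. 2.18 (local factors on GL(2))]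
[cite: Gelbart1975, Thm. 6.15 (L-factor table) and Thm. 4.23 (class-one representations)] -/
def JacquetLanglands1970_spherical_of_natDegree_lFactor_eq_two : Prop :=
  ∀ (F : Type) [Field F] [ValuativeRel F] [TopologicalSpace F] [IsNonarchimedeanLocalField F]
    [CharZero F] (πv : SmoothIrrep (GL (Fin 2) F)) (ψ : AddChar F Circle), ψ.IsContinuousNontrivial →
    IsGeneric πv.ρ ψ →
    (∀ [MeasurableSpace (GL (Fin 1) F ⧸ upperUnitriangular (Fin 1) F)]
      [BorelSpace (GL (Fin 1) F ⧸ upperUnitriangular (Fin 1) F)]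
      (ν : Measure (GL (Fin 1) F ⧸ upperUnitriangular (Fin 1) F))
      [SMulInvariantMeasure (GL (Fin 1) F) (GL (Fin 1) F ⧸ upperUnitriangular (Fin 1) F) ν]
      [IsFiniteMeasureOnCompacts ν] [ν.IsOpenPosMeasure],
      ∃ P : ℂ[X], HasRSLFactor Nat.one_lt_two πv.ρ (Representation.trivial ℂ (GL (Fin 1) F) ℂ) ψ ν P ∧
        P.natDegree = 2) →
    ∃ x : πv.V, x ≠ 0 ∧ x ∈ πv.ρ.fixedPoints (glInt 2 F)

/-- **Discharge of `JacquetLanglands1970_spherical_of_natDegree_lFactor_eq_two`** by the tree's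
theorem `exists_mem_fixedPoints_glInt_of_hasRSLFactor_natDegree_two`
(`GL2SphericalOfLFactorDegreeTwo`: torus asymptotics of Whittaker functions bound the number of
poles of `L(s, π × 1)` by the unramified part of the Jacquet module — `WhittakerTorusJacquetGL2` —
and a two-dimensional unramified Jacquet module forces `π ≅ Ind(χ₁, χ₂)` with `χ₁, χ₂` unramified
and irreducible, whence a spherical vector — `PrincipalSeriesGL2JacquetModule`); genericity and
`char F = 0` are not used. [cite: JacquetLanglands1970, Props. 3.5–3.6 and Thm. 2.18]
[cite: Gelbart1975, Thm. 6.15 with Thm. 4.23] -/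
theorem JacquetLanglands1970_spherical_of_natDegree_lFactor_eq_two_holds :
    JacquetLanglands1970_spherical_of_natDegree_lFactor_eq_two :=
  fun _ _ _ _ _ _ πv ψ hψ _ hL =>
    exists_mem_fixedPoints_glInt_of_hasRSLFactor_natDegree_two πv ψ hψ hL

end Literature.NumberTheory.Automorphic

end
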